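import Summits.CriticalPhenomena.SAWScalingLimit.Theses.SAWLoopFugacityFlow
import Literature.Probability.RandomPlanarGeometry.SAWParafermion

/-!
# Negative-side results for the crux `SAWLoopFugacityFlow.SimpleSubseqLimits` (stmt-CriticalPhenomena-4982):
LOAD-BEARING ANALYSIS — the two endpoint-limit fields of `IsEndpointApprox` (work-file §2).

Dropping `tendsto_fst : δ · a δ → D.pt 0` (or `tendsto_snd`, or the whole hypothesis
`IsEndpointApprox D a b`) from the crux makes it FALSE, in EVERY Dobrushin domain: take coincident
endpoints `a δ = b δ = nearestSite δ (D.pt 1)`; they are joined in `Ω_δ` trivially (reflexivity —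
the loophole of `IsEndpointApprox.reachable`), the only SAW is the trivial walk, the critical SAW law
is the Dirac mass at it, its curve is the constant curve at `δ · b δ → D.pt 1`, so along `s n = 1/(n+1)`
the laws converge weakly to the Dirac mass at the CONSTANT curve class at `D.pt 1` — a probability
measure that violates the simplicity clause (a constant class has equal endpoints, hence no injective
representative) and the clause `source = D.pt 0`. Any proof of the crux must use both endpoint
limits, already for simplicity alone.

Refuter `cdisprove` (standing adversary); the full indexed work file is
`Summits/CriticalPhenomena/SAWScalingLimit/Cruxes/SimpleSubseqLimits/Disproof.lean`.
-/

noncomputable section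

open MeasureTheory Filter Topology Set Metric
open Literature.Probability.RandomPlanarGeometry Literature.Probability.RandomPlanarGeometry.SAW
open Literature.Probability.LatticeModels
open scoped ENNReal NNReal BoundedContinuousFunction

namespace Summit.CriticalPhenomena.SAWScalingLimit.Theorems.SimpleSubseqLimits.Negative

open Summit.CriticalPhenomena.SAWScalingLimit.Theses.SAWLoopFugacityFlow (SimpleSubseqLimits)

/-! ## The law at coincident endpoints -/

section Coincident

variable {Ω : Set ℂ} {δ : ℝ}

/-- Singletons of the discrete type of SAWs are measurable (`⊤` σ-algebra). [folklore] -/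
instance instMeasurableSingletonClassDomainSAW (a b : Site 2) :
    MeasurableSingletonClass (DomainSAW Ω δ a b) :=
  ⟨fun _ => MeasurableSpace.measurableSet_top⟩

/-- At coincident endpoints the critical weight is the Dirac mass at the trivial walk
(`x_c ^ 0 = 1`). [folklore] -/
theorem weight_self (Ω : Set ℂ) (δ : ℝ) (e : Site 2) :
    weight Ω δ e e = Measure.dirac (DomainSAW.nil e) := by
  ext s hs
  rw [weight, Measure.sum_apply _ hs, tsum_fintype, Finset.univ_unique, Finset.sum_singleton]
  simp [show (default : DomainSAW Ω δ e e) = DomainSAW.nil e from rfl]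

/-- At coincident endpoints the critical SAW law is the Dirac mass at the trivial walk — for EVERY
`Ω` and `δ`, also at a vertex outside the discrete domain. [folklore] -/
theorem law_self (Ω : Set ℂ) (δ : ℝ) (e : Site 2) :
    law Ω δ e e = Measure.dirac (DomainSAW.nil e) := by
  rw [law, weight_self, Measure.dirac_apply_of_mem (mem_univ _), inv_one, one_smul]

/-- The curve class of the trivial walk is the class of the constant curve at the mesh point.
[folklore] -/
theorem curve_nil (e : Site 2) :
    (DomainSAW.nil e : DomainSAW Ω δ e e).curve = CurveClass.mk (Curve.const (meshPoint δ e)) := by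
  simp only [DomainSAW.curve, DomainSAW.nil]
  congr 1

/-- Test integrals against the law at coincident endpoints: evaluation at the constant class.
[folklore] -/
theorem integral_law_self (f : CurveClass ℂ →ᵇ ℝ) (e : Site 2) :
    ∫ γ, f γ.curve ∂(law Ω δ e e) = f (CurveClass.mk (Curve.const (meshPoint δ e))) := by
  rw [law_self, integral_dirac, curve_nil]

end Coincident

/-! ## Constant curve classes -/

/-- Classes of constant curves are as close as their points. [folklore] -/
theorem dist_mk_const_le (p q : ℂ) :
    dist (CurveClass.mk (Curve.const p)) (CurveClass.mk (Curve.const q)) ≤ dist p q := by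
  rw [CurveClass.dist_mk_mk]
  refine (Curve.dist_le_dist_toContinuousMap _ _).trans ?_
  exact (ContinuousMap.dist_le dist_nonneg).2 fun _ => le_rfl

/-- **A constant curve class is never simple**: `source` and `target` are class invariants, and
an injective representative would have distinct endpoints. [folklore] -/
theorem mk_const_not_mem_simple (p : ℂ) : CurveClass.mk (Curve.const p) ∉ CurveClass.simple := by
  rintro ⟨γ, hγ, h⟩
  have h0 : γ.source = (Curve.const p).source := by simpa using congrArg CurveClass.source h
  have h1 : γ.target = (Curve.const p).target := by simpa using congrArg CurveClass.target h
  rw [Curve.source_def, Curve.source_def, Curve.const_apply] at h0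
  rw [Curve.target_def, Curve.target_def, Curve.const_apply] at h1
  have : (0 : unitInterval) = 1 := hγ (h0.trans h1.symm)
  exact zero_ne_one this

/-- A Dirac mass at a constant class violates the simplicity clause a.e. [folklore] -/
theorem not_ae_simple_dirac_const (p : ℂ) :
    ¬ ∀ᵐ γ ∂(Measure.dirac (CurveClass.mk (Curve.const p))), γ ∈ CurveClass.simple := by
  intro h
  rw [ae_iff] at h
  have h1 : Measure.dirac (CurveClass.mk (Curve.const p))
      {γ : CurveClass ℂ | ¬ γ ∈ CurveClass.simple} = 1 :=
    Measure.dirac_apply_of_mem (mk_const_not_mem_simple p)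
  rw [h1] at h
  exact one_ne_zero h

/-! ## The witnesses -/

/-- The endpoint family `δ ↦ nearestSite δ z` approximates `z` (within `δ`). [folklore] -/
theorem tendsto_meshPoint_nearestSite (z : ℂ) :
    Tendsto (fun δ => meshPoint δ (nearestSite δ z)) (𝓝[>] (0 : ℝ)) (𝓝 z) := by
  rw [tendsto_iff_dist_tendsto_zero]
  have h0 : Tendsto (fun δ : ℝ => δ) (𝓝[>] (0 : ℝ)) (𝓝 0) := nhdsWithin_le_nhds
  refine squeeze_zero' (Eventually.of_forall fun _ => dist_nonneg) ?_ h0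
  filter_upwards [self_mem_nhdsWithin] with δ hδ
  exact dist_meshPoint_nearestSite_le hδ z

/-- The standard positive null sequence `s n = 1/(n+1)`. [folklore] -/
theorem tendsto_one_div_succ : Tendsto (fun n : ℕ => 1 / ((n : ℝ) + 1)) atTop (𝓝[>] (0 : ℝ)) :=
  tendsto_nhdsWithin_iff.2 ⟨tendsto_one_div_add_atTop_nhds_zero_nat,
    Eventually.of_forall fun n => mem_Ioi.2 (by positivity)⟩

/-- **The weak limit at coincident endpoints.** If `a δ = b δ =: e δ` and `δ · e δ → p`, then along
any `s n → 0⁺` the critical SAW laws converge weakly (on bounded continuous test functions of the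
curve) to the Dirac mass at the constant class at `p`. [folklore] -/
theorem tendsto_integral_law_self {D : DobrushinDomain} {e : ℝ → Site 2} {s : ℕ → ℝ} {p : ℂ}
    (hs : Tendsto s atTop (𝓝[>] (0 : ℝ)))
    (he : Tendsto (fun δ => meshPoint δ (e δ)) (𝓝[>] (0 : ℝ)) (𝓝 p)) (f : CurveClass ℂ →ᵇ ℝ) :
    Tendsto (fun n => ∫ γ, f γ.curve ∂(law D.carrier (s n) (e (s n)) (e (s n)))) atTop
      (𝓝 (∫ x, f x ∂(Measure.dirac (CurveClass.mk (Curve.const p))))) := by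
  simp only [integral_law_self, integral_dirac]
  refine (f.continuous.tendsto _).comp ?_
  have h2 : Tendsto (fun n => meshPoint (s n) (e (s n))) atTop (𝓝 p) := he.comp hs
  rw [tendsto_iff_dist_tendsto_zero] at h2 ⊢
  exact squeeze_zero (fun _ => dist_nonneg) (fun n => dist_mk_const_le _ _) h2

/-- `SimpleSubseqLimits` with `IsEndpointApprox D a b` weakened by DROPPING the first endpoint
limit `tendsto_fst : δ · a δ → D.pt 0` (keeping `reachable` and `tendsto_snd`), conclusion
verbatim — a deliberately FALSE weakening, refuted below (not a literature fact). -/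
def SimpleSubseqLimitsWithoutTendstoFst : Prop :=
  ∀ (D : DobrushinDomain) (a b : ℝ → Site 2),
    (∀ᶠ δ in 𝓝[>] (0 : ℝ), (discreteDomainGraph D.carrier δ).Reachable (a δ) (b δ)) →
    Tendsto (fun δ => meshPoint δ (b δ)) (𝓝[>] (0 : ℝ)) (𝓝 (D.pt 1)) →
    ∀ (s : ℕ → ℝ) (ν : Measure (CurveClass ℂ)), Tendsto s atTop (𝓝[>] (0 : ℝ)) →
      IsProbabilityMeasure ν →
      (∀ f : CurveClass ℂ →ᵇ ℝ,
        Tendsto (fun n => ∫ γ, f γ.curve ∂(law D.carrier (s n) (a (s n)) (b (s n)))) atTop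
          (𝓝 (∫ x, f x ∂ν))) →
      ∀ᵐ γ ∂ν, γ ∈ CurveClass.simple ∧ γ.source = D.pt 0 ∧ γ.target = D.pt 1 ∧
        γ.range ⊆ closure D.carrier ∧ γ.range ∩ frontier D.carrier ⊆ {D.pt 0, D.pt 1}

/-- `SimpleSubseqLimits` with `IsEndpointApprox D a b` weakened by DROPPING the second endpoint
limit `tendsto_snd : δ · b δ → D.pt 1` (keeping `reachable` and `tendsto_fst`), conclusion
verbatim — a deliberately FALSE weakening, refuted below (not a literature fact). -/
def SimpleSubseqLimitsWithoutTendstoSnd : Prop :=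
  ∀ (D : DobrushinDomain) (a b : ℝ → Site 2),
    (∀ᶠ δ in 𝓝[>] (0 : ℝ), (discreteDomainGraph D.carrier δ).Reachable (a δ) (b δ)) →
    Tendsto (fun δ => meshPoint δ (a δ)) (𝓝[>] (0 : ℝ)) (𝓝 (D.pt 0)) →
    ∀ (s : ℕ → ℝ) (ν : Measure (CurveClass ℂ)), Tendsto s atTop (𝓝[>] (0 : ℝ)) →
      IsProbabilityMeasure ν →
      (∀ f : CurveClass ℂ →ᵇ ℝ,
        Tendsto (fun n => ∫ γ, f γ.curve ∂(law D.carrier (s n) (a (s n)) (b (s n)))) atTop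
          (𝓝 (∫ x, f x ∂ν))) →
      ∀ᵐ γ ∂ν, γ ∈ CurveClass.simple ∧ γ.source = D.pt 0 ∧ γ.target = D.pt 1 ∧
        γ.range ⊆ closure D.carrier ∧ γ.range ∩ frontier D.carrier ⊆ {D.pt 0, D.pt 1}

/-- `SimpleSubseqLimits` with the hypothesis `IsEndpointApprox D a b` dropped altogether — a
deliberately FALSE weakening, refuted below (not a literature fact). -/
def SimpleSubseqLimitsWithoutEndpointApprox : Prop :=
  ∀ (D : DobrushinDomain) (a b : ℝ → Site 2) (s : ℕ → ℝ) (ν : Measure (CurveClass ℂ)),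
    Tendsto s atTop (𝓝[>] (0 : ℝ)) → IsProbabilityMeasure ν →
      (∀ f : CurveClass ℂ →ᵇ ℝ,
        Tendsto (fun n => ∫ γ, f γ.curve ∂(law D.carrier (s n) (a (s n)) (b (s n)))) atTop
          (𝓝 (∫ x, f x ∂ν))) →
      ∀ᵐ γ ∂ν, γ ∈ CurveClass.simple ∧ γ.source = D.pt 0 ∧ γ.target = D.pt 1 ∧
        γ.range ⊆ closure D.carrier ∧ γ.range ∩ frontier D.carrier ⊆ {D.pt 0, D.pt 1}

/-- The crux implies each weakened form's negation is informative: trivially the crux is the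
weakened statement restricted to honest approximations. [folklore] -/
theorem simpleSubseqLimits_of_withoutTendstoFst (h : SimpleSubseqLimitsWithoutTendstoFst) :
    SimpleSubseqLimits :=
  fun D a b hab s ν hs hν hw => h D a b hab.reachable hab.tendsto_snd s ν hs hν hw

/-- Symmetric companion of `simpleSubseqLimits_of_withoutTendstoFst`. [folklore] -/
theorem simpleSubseqLimits_of_withoutTendstoSnd (h : SimpleSubseqLimitsWithoutTendstoSnd) :
    SimpleSubseqLimits :=
  fun D a b hab s ν hs hν hw => h D a b hab.reachable hab.tendsto_fst s ν hs hν hw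

/-- **Per-domain witness without `tendsto_fst`.** In EVERY Dobrushin domain the coincident
endpoints `a δ = b δ = nearestSite δ (D.pt 1)` are joined, approximate `b`, and the SAW laws along
`1/(n+1)` converge weakly to the Dirac mass at the constant curve at `b`, a probability measure
violating the simplicity clause. [folklore] -/
theorem exists_badLimit_without_tendsto_fst (D : DobrushinDomain) :
    ∃ (a b : ℝ → Site 2) (s : ℕ → ℝ) (ν : Measure (CurveClass ℂ)),
      (∀ᶠ δ in 𝓝[>] (0 : ℝ), (discreteDomainGraph D.carrier δ).Reachable (a δ) (b δ)) ∧
      Tendsto (fun δ => meshPoint δ (b δ)) (𝓝[>] (0 : ℝ)) (𝓝 (D.pt 1)) ∧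
      Tendsto s atTop (𝓝[>] (0 : ℝ)) ∧ IsProbabilityMeasure ν ∧
      (∀ f : CurveClass ℂ →ᵇ ℝ,
        Tendsto (fun n => ∫ γ, f γ.curve ∂(law D.carrier (s n) (a (s n)) (b (s n)))) atTop
          (𝓝 (∫ x, f x ∂ν))) ∧
      ¬ ∀ᵐ γ ∂ν, γ ∈ CurveClass.simple :=
  ⟨fun δ => nearestSite δ (D.pt 1), fun δ => nearestSite δ (D.pt 1), fun n => 1 / ((n : ℝ) + 1),
    Measure.dirac (CurveClass.mk (Curve.const (D.pt 1))),
    Eventually.of_forall fun _ => SimpleGraph.Reachable.refl _, tendsto_meshPoint_nearestSite _,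
    tendsto_one_div_succ, inferInstance,
    tendsto_integral_law_self (D := D) (e := fun δ => nearestSite δ (D.pt 1))
      (s := fun n : ℕ => 1 / ((n : ℝ) + 1)) (p := D.pt 1) tendsto_one_div_succ
      (tendsto_meshPoint_nearestSite (D.pt 1)),
    not_ae_simple_dirac_const _⟩

/-- **Per-domain witness without `tendsto_snd`** (coincident endpoints at `a`). [folklore] -/
theorem exists_badLimit_without_tendsto_snd (D : DobrushinDomain) :
    ∃ (a b : ℝ → Site 2) (s : ℕ → ℝ) (ν : Measure (CurveClass ℂ)),
      (∀ᶠ δ in 𝓝[>] (0 : ℝ), (discreteDomainGraph D.carrier δ).Reachable (a δ) (b δ)) ∧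
      Tendsto (fun δ => meshPoint δ (a δ)) (𝓝[>] (0 : ℝ)) (𝓝 (D.pt 0)) ∧
      Tendsto s atTop (𝓝[>] (0 : ℝ)) ∧ IsProbabilityMeasure ν ∧
      (∀ f : CurveClass ℂ →ᵇ ℝ,
        Tendsto (fun n => ∫ γ, f γ.curve ∂(law D.carrier (s n) (a (s n)) (b (s n)))) atTop
          (𝓝 (∫ x, f x ∂ν))) ∧
      ¬ ∀ᵐ γ ∂ν, γ ∈ CurveClass.simple :=
  ⟨fun δ => nearestSite δ (D.pt 0), fun δ => nearestSite δ (D.pt 0), fun n => 1 / ((n : ℝ) + 1),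
    Measure.dirac (CurveClass.mk (Curve.const (D.pt 0))),
    Eventually.of_forall fun _ => SimpleGraph.Reachable.refl _, tendsto_meshPoint_nearestSite _,
    tendsto_one_div_succ, inferInstance,
    tendsto_integral_law_self (D := D) (e := fun δ => nearestSite δ (D.pt 0))
      (s := fun n : ℕ => 1 / ((n : ℝ) + 1)) (p := D.pt 0) tendsto_one_div_succ
      (tendsto_meshPoint_nearestSite (D.pt 0)),
    not_ae_simple_dirac_const _⟩

/-- **`tendsto_fst` is load-bearing**: `SimpleSubseqLimits` without it is FALSE (witness in the
unit disc; any domain works, `exists_badLimit_without_tendsto_fst`). [folklore] -/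
theorem simpleSubseqLimits_false_without_tendsto_fst : ¬ SimpleSubseqLimitsWithoutTendstoFst := by
  intro h
  obtain ⟨a, b, s, ν, hr, hb, hs, hν, hw, hbad⟩ :=
    exists_badLimit_without_tendsto_fst DobrushinDomain.unitDisc
  exact hbad ((h _ a b hr hb s ν hs hν hw).mono fun γ hγ => hγ.1)

/-- **`tendsto_snd` is load-bearing**: `SimpleSubseqLimits` without it is FALSE. [folklore] -/
theorem simpleSubseqLimits_false_without_tendsto_snd : ¬ SimpleSubseqLimitsWithoutTendstoSnd := by
  intro h
  obtain ⟨a, b, s, ν, hr, ha, hs, hν, hw, hbad⟩ :=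
    exists_badLimit_without_tendsto_snd DobrushinDomain.unitDisc
  exact hbad ((h _ a b hr ha s ν hs hν hw).mono fun γ hγ => hγ.1)

/-- A fortiori `SimpleSubseqLimits` without `IsEndpointApprox` is FALSE. [folklore] -/
theorem simpleSubseqLimits_false_without_endpointApprox :
    ¬ SimpleSubseqLimitsWithoutEndpointApprox := fun h =>
  simpleSubseqLimits_false_without_tendsto_fst fun D a b _ _ s ν hs hν hw => h D a b s ν hs hν hw

end Summit.CriticalPhenomena.SAWScalingLimit.Theorems.SimpleSubseqLimits.Negative
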